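import Mathlib
import Summits.Ventures.PercRepro2.Defs
import Summits.Ventures.PercRepro2.Independence
import Summits.Ventures.PercRepro2.Harris
import Summits.Ventures.PercRepro2.Graph
import Summits.Ventures.PercRepro2.Events
import Summits.Ventures.PercRepro2.ZCClusterBlind
import Summits.Ventures.PercRepro2.ZCRootDecomp
import Summits.Ventures.PercRepro2.ZCCondProb
import Summits.Ventures.PercRepro2.ZCThetaPA
import Summits.Ventures.PercRepro2.CondAvoidPA
import Summits.Ventures.PercRepro2.ZCDirectCube
import Summits.Ventures.PercRepro2.ZCDirectFibre

/-!
# `(ZC-direct)`, part 2: the influence of the root edges into a cluster, and the tower identities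
(blind cell PercRepro2, mine-a g29)

`I(C) = P(U) − P(U ∘ clear_C)` (`Iprop`), the influence of the edges of `a₁` into `C` on the
direct-attachment event; `fI v ω = I(C_ω(v))` is a monotone cluster property with values in `[0, 1]`
(`isMonotoneClusterProperty_fI`).  The fibre covariance of `U` with `{a₁ ↔ a₃}` is `P(Xᶜ)·I(C'(a₃))`
(`fib_cov_eq`, via the factorisation `prob_fibU_inter_compl`).  Tower identities over the split
`ω = glue σ₁ τ` (`prob_eq_sum_fib`, `expect_eq_sum_fib`, `prob_directEvent`) and the cube step in
probability form (`cube_step_prob`).  MINE-A.md §83.1 (3)–(4).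
-/

namespace Summit.Ventures.PercRepro2

namespace ZCDirect

variable {V : Type*} {E : Type*} [Fintype V] [DecidableEq V] [Fintype E] [DecidableEq E]
  {R : Type*} [Field R] [LinearOrder R] [IsStrictOrderedRing R]

variable (ends : E → Sym2 V) (a₁ : V)

/-! ## The influence identity on the fibre and the cluster property -/

omit [Fintype E] [DecidableEq E] in
/-- The complement of the fibre of `{a₁ ↔ x}`: every edge into `C'(x)` is closed. -/
lemma mem_compl_fib_conn_iff (σ₁ : {e // e ∈ awayEdges ends a₁} → Bool) {x : V} (hx : x ≠ a₁)
    (τ : {e // e ∉ awayEdges ends a₁} → Bool) :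
    τ ∈ (fib ends a₁ (connEvent ends a₁ x) σ₁)ᶜ ↔
      ∀ e ∈ into ends a₁ (cluster ends (baseConfig ends a₁ σ₁) x), τ e = false := by
  rw [Set.mem_compl_iff, mem_fib_conn_iff ends a₁ σ₁ hx]
  simp only [not_exists, not_and, Bool.not_eq_true]

omit [Fintype V] [DecidableEq V] [Fintype E] [DecidableEq E] in
/-- `clearInto C τ ≤ τ`. -/
lemma clearInto_le (C : Set V) (τ : {e // e ∉ awayEdges ends a₁} → Bool) :
    clearInto ends a₁ C τ ≤ τ := by
  intro e
  unfold clearInto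
  split_ifs
  · exact Bool.false_le _
  · exact le_rfl

omit [Fintype V] [DecidableEq V] [Fintype E] [DecidableEq E] in
/-- Closing more edges gives a smaller configuration. -/
lemma clearInto_anti {C C' : Set V} (h : C ⊆ C') (τ : {e // e ∉ awayEdges ends a₁} → Bool) :
    clearInto ends a₁ C' τ ≤ clearInto ends a₁ C τ := by
  intro e
  unfold clearInto
  by_cases h1 : e ∈ into ends a₁ C
  · have h2 : e ∈ into ends a₁ C' := by
      obtain ⟨v, hv, hends⟩ := h1
      exact ⟨v, h hv, hends⟩
    simp [h1, h2]
  · by_cases h2 : e ∈ into ends a₁ C'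
    · simp [h1, h2]
    · simp [h1, h2]

omit [Fintype V] [DecidableEq V] [Fintype E] [DecidableEq E] in
/-- On configurations with every edge into `C` closed, `clearInto C` is the identity. -/
lemma clearInto_eq_self {C : Set V} {τ : {e // e ∉ awayEdges ends a₁} → Bool}
    (h : ∀ e ∈ into ends a₁ C, τ e = false) : clearInto ends a₁ C τ = τ := by
  funext e
  unfold clearInto
  split_ifs with he
  · exact (h e he).symm
  · rfl

omit [Fintype V] [DecidableEq V] [Fintype E] [DecidableEq E] in
/-- `clearInto C τ` only depends on the edges outside `into C`. -/
lemma clearInto_congr {C : Set V} {τ τ' : {e // e ∉ awayEdges ends a₁} → Bool}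
    (h : ∀ e ∈ (into ends a₁ C)ᶜ, τ e = τ' e) :
    clearInto ends a₁ C τ = clearInto ends a₁ C τ' := by
  funext e
  unfold clearInto
  split_ifs with he
  · rfl
  · exact h e he

/-- The influence of the edges into `C` on the direct-attachment event. -/
noncomputable def Iprop (p : E → R) (𝓔 : Set (Set V)) (C : Set V) : R :=
  prob (fun i : {e // e ∉ awayEdges ends a₁} => p i) (fibU ends a₁ 𝓔) -
    prob (fun i : {e // e ∉ awayEdges ends a₁} => p i)
      {τ | clearInto ends a₁ C τ ∈ fibU ends a₁ 𝓔}

/-- The influence as a cluster property: `I(C(v))`. -/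
noncomputable def fI (p : E → R) (𝓔 : Set (Set V)) : V → Config E → R :=
  fun v ω => Iprop ends a₁ p 𝓔 (cluster ends ω v)

omit [Fintype V] [DecidableEq V] [Fintype E] [DecidableEq E] [IsStrictOrderedRing R] in
/-- The restricted weights are admissible. -/
lemma isProbVec_restrict {p : E → R} (hp : IsProbVec p) :
    IsProbVec (fun i : {e // e ∉ awayEdges ends a₁} => p i) :=
  ⟨fun i => hp.nonneg i, fun i => hp.le_one i⟩

/-- `0 ≤ Iprop`. -/
lemma Iprop_nonneg {p : E → R} (hp : IsProbVec p) {𝓔 : Set (Set V)} (h𝓔 : IsUpperSet 𝓔)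
    (C : Set V) : 0 ≤ Iprop ends a₁ p 𝓔 C := by
  unfold Iprop
  rw [sub_nonneg]
  refine prob_mono (isProbVec_restrict ends a₁ hp) fun τ hτ => ?_
  exact isUpperSet_fibU ends a₁ h𝓔 (clearInto_le ends a₁ C τ) hτ

/-- `Iprop ≤ 1`. -/
lemma Iprop_le_one {p : E → R} (hp : IsProbVec p) (𝓔 : Set (Set V))
    (C : Set V) : Iprop ends a₁ p 𝓔 C ≤ 1 := by
  unfold Iprop
  have h1 := prob_le_one (isProbVec_restrict ends a₁ hp) (fibU ends a₁ 𝓔)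
  have h2 := prob_nonneg (isProbVec_restrict ends a₁ hp)
    {τ | clearInto ends a₁ C τ ∈ fibU ends a₁ 𝓔}
  linarith

/-- `Iprop` is monotone in the cluster. -/
lemma Iprop_mono {p : E → R} (hp : IsProbVec p) {𝓔 : Set (Set V)} (h𝓔 : IsUpperSet 𝓔)
    {C C' : Set V} (h : C ⊆ C') : Iprop ends a₁ p 𝓔 C ≤ Iprop ends a₁ p 𝓔 C' := by
  unfold Iprop
  have : prob (fun i : {e // e ∉ awayEdges ends a₁} => p i)
      {τ | clearInto ends a₁ C' τ ∈ fibU ends a₁ 𝓔} ≤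
      prob (fun i : {e // e ∉ awayEdges ends a₁} => p i)
        {τ | clearInto ends a₁ C τ ∈ fibU ends a₁ 𝓔} :=
    prob_mono (isProbVec_restrict ends a₁ hp) fun τ hτ =>
      isUpperSet_fibU ends a₁ h𝓔 (clearInto_anti ends a₁ h τ) hτ
  linarith

/-- `fI` is a monotone cluster property. -/
lemma isMonotoneClusterProperty_fI {p : E → R} (hp : IsProbVec p) {𝓔 : Set (Set V)}
    (h𝓔 : IsUpperSet 𝓔) : IsMonotoneClusterProperty ends (fI ends a₁ p 𝓔) where
  mono := fun _ _ _ h => Iprop_mono ends a₁ hp h𝓔 h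
  eq_of_openAdj := fun _ _ _ h => by
    unfold fI
    rw [cluster_eq_of_conn (conn_of_openAdj h)]

omit [LinearOrder R] [IsStrictOrderedRing R] in
/-- The fibre of the direct-attachment event intersected with `{a₁ ↮ a₃}` factorises. -/
lemma prob_fibU_inter_compl (p : E → R) (𝓔 : Set (Set V))
    (σ₁ : {e // e ∈ awayEdges ends a₁} → Bool) {a₃ : V} (h3 : a₃ ≠ a₁) :
    prob (fun i : {e // e ∉ awayEdges ends a₁} => p i)
        (fibU ends a₁ 𝓔 ∩ (fib ends a₁ (connEvent ends a₁ a₃) σ₁)ᶜ) =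
      prob (fun i : {e // e ∉ awayEdges ends a₁} => p i)
          {τ | clearInto ends a₁ (cluster ends (baseConfig ends a₁ σ₁) a₃) τ ∈ fibU ends a₁ 𝓔} *
        prob (fun i : {e // e ∉ awayEdges ends a₁} => p i)
          (fib ends a₁ (connEvent ends a₁ a₃) σ₁)ᶜ := by
  set C := cluster ends (baseConfig ends a₁ σ₁) a₃ with hC
  have hset : fibU ends a₁ 𝓔 ∩ (fib ends a₁ (connEvent ends a₁ a₃) σ₁)ᶜ =
      {τ | clearInto ends a₁ C τ ∈ fibU ends a₁ 𝓔} ∩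
        (fib ends a₁ (connEvent ends a₁ a₃) σ₁)ᶜ := by
    ext τ
    simp only [Set.mem_inter_iff, Set.mem_setOf_eq]
    constructor
    · rintro ⟨h1, h2⟩
      refine ⟨?_, h2⟩
      rw [clearInto_eq_self ends a₁ ((mem_compl_fib_conn_iff ends a₁ σ₁ h3 τ).1 h2)]
      exact h1
    · rintro ⟨h1, h2⟩
      refine ⟨?_, h2⟩
      rw [clearInto_eq_self ends a₁ ((mem_compl_fib_conn_iff ends a₁ σ₁ h3 τ).1 h2)] at h1
      exact h1
  rw [hset]
  refine prob_inter_eq_mul_of_dependsOn _ (disjoint_compl_left (a := into ends a₁ C)) ?_ ?_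
  · intro τ τ' h
    apply propext
    show clearInto ends a₁ C τ ∈ fibU ends a₁ 𝓔 ↔ clearInto ends a₁ C τ' ∈ fibU ends a₁ 𝓔
    rw [clearInto_congr ends a₁ h]
  · exact dependsOn_compl (dependsOn_fib_conn ends a₁ σ₁ h3)


/-! ## Tower identities over the split `ω = glue σ₁ τ` -/

section Tower

variable (p : E → R)

omit [Fintype V] [DecidableEq V] [LinearOrder R] [IsStrictOrderedRing R] in
/-- `E[1_A 1_B] = P(A ∩ B)`. -/
lemma expect_indicator_mul_indicator (A B : Set (Config E)) :
    expect p (fun ω => A.indicator 1 ω * B.indicator 1 ω) = prob p (A ∩ B) := by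
  rw [prob_eq_expect_indicator]
  unfold expect
  refine Finset.sum_congr rfl fun ω _ => ?_
  show weight p ω * (A.indicator 1 ω * B.indicator 1 ω) = weight p ω * (A ∩ B).indicator 1 ω
  rw [← indicator_inter_one]

omit [Fintype V] [DecidableEq V] [LinearOrder R] [IsStrictOrderedRing R] in
/-- `E[f 1_{A ∪ B}] = E[f 1_A] + E[f 1_B]` for disjoint `A`, `B`. -/
lemma expect_mul_indicator_union (f : Config E → R) {A B : Set (Config E)} (h : Disjoint A B) :
    expect p (fun ω => f ω * (A ∪ B).indicator 1 ω) =
      expect p (fun ω => f ω * A.indicator 1 ω) + expect p (fun ω => f ω * B.indicator 1 ω) := by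
  rw [← expect_add]
  unfold expect
  refine Finset.sum_congr rfl fun ω _ => ?_
  rw [Set.indicator_union_of_disjoint h]
  simp only [Pi.add_apply]
  ring

omit [LinearOrder R] [IsStrictOrderedRing R] in
/-- A probability as the `σ₁`-average of the fibre probabilities. -/
lemma prob_eq_sum_fib (A : Set (Config E)) :
    prob p A = ∑ σ₁ : {e // e ∈ awayEdges ends a₁} → Bool,
      weight (fun i : {e // e ∈ awayEdges ends a₁} => p i) σ₁ *
        prob (fun i : {e // e ∉ awayEdges ends a₁} => p i) (fib ends a₁ A σ₁) := by
  rw [prob_eq_expect_indicator, expect_eq_sum_glue p _ (awayEdges ends a₁)]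
  refine Finset.sum_congr rfl fun σ₁ _ => ?_
  unfold prob
  rw [Finset.mul_sum]
  refine Finset.sum_congr rfl fun τ _ => ?_
  by_cases h : glue (awayEdges ends a₁) σ₁ τ ∈ A
  · have h' : τ ∈ fib ends a₁ A σ₁ := h
    simp [h, h']
  · have h' : τ ∉ fib ends a₁ A σ₁ := h
    simp [h, h']

omit [LinearOrder R] [IsStrictOrderedRing R] in
/-- The weights of `G − a₁` sum to one. -/
lemma sum_weight_away :
    ∑ σ₁ : {e // e ∈ awayEdges ends a₁} → Bool,
      weight (fun i : {e // e ∈ awayEdges ends a₁} => p i) σ₁ = 1 :=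
  sum_weight _

omit [LinearOrder R] [IsStrictOrderedRing R] in
/-- The probability of the direct-attachment event is its fibre probability. -/
lemma prob_directEvent (𝓔 : Set (Set V)) :
    prob p (directEvent ends a₁ 𝓔) =
      prob (fun i : {e // e ∉ awayEdges ends a₁} => p i) (fibU ends a₁ 𝓔) := by
  rw [prob_eq_sum_fib ends a₁ p]
  have h : ∀ σ₁ : {e // e ∈ awayEdges ends a₁} → Bool,
      fib ends a₁ (directEvent ends a₁ 𝓔) σ₁ = fibU ends a₁ 𝓔 :=
    fib_directEvent ends a₁ 𝓔
  simp only [h]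
  rw [← Finset.sum_mul, sum_weight_away, one_mul]

omit [LinearOrder R] [IsStrictOrderedRing R] in
/-- An expectation as the `σ₁`-average of the fibre expectations. -/
lemma expect_eq_sum_fib (f : Config E → R) :
    expect p f = ∑ σ₁ : {e // e ∈ awayEdges ends a₁} → Bool,
      weight (fun i : {e // e ∈ awayEdges ends a₁} => p i) σ₁ *
        expect (fun i : {e // e ∉ awayEdges ends a₁} => p i)
          (fun τ => f (glue (awayEdges ends a₁) σ₁ τ)) := by
  rw [expect_eq_sum_glue p _ (awayEdges ends a₁)]
  refine Finset.sum_congr rfl fun σ₁ _ => ?_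
  unfold expect
  rw [Finset.mul_sum]
  refine Finset.sum_congr rfl fun τ _ => ?_
  ring

end Tower

/-! ## The theorem -/

section Main

variable (p : E → R)

omit [Fintype E] [DecidableEq E] [LinearOrder R] [IsStrictOrderedRing R] in
/-- The fibre of an intersection with the direct-attachment event. -/
lemma fib_directEvent_inter (𝓔 : Set (Set V)) (A : Set (Config E))
    (σ₁ : {e // e ∈ awayEdges ends a₁} → Bool) :
    fib ends a₁ (directEvent ends a₁ 𝓔 ∩ A) σ₁ = fibU ends a₁ 𝓔 ∩ fib ends a₁ A σ₁ := by
  rw [← fib_directEvent ends a₁ 𝓔 σ₁]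
  rfl

/-- The cube step in probability form. -/
lemma cube_step_prob {p₂ : {e // e ∉ awayEdges ends a₁} → R} (hp : IsProbVec p₂)
    {Uf X W : Set ({e // e ∉ awayEdges ends a₁} → Bool)} (hU : IsUpperSet Uf)
    (hX : IsUpperSet X) (hW : IsUpperSet W) (hind : prob p₂ (X ∩ W) = prob p₂ X * prob p₂ W)
    {S b : R} (hS : 0 ≤ S) :
    (S * prob p₂ W - b) * (prob p₂ (Uf ∩ X) - prob p₂ Uf * prob p₂ X) ≤
      S * (prob p₂ (Uf ∩ (X ∩ W)) - prob p₂ Uf * prob p₂ (X ∩ W)) -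
        b * (prob p₂ (Uf ∩ X) - prob p₂ Uf * prob p₂ X) := by
  have h := cube_step (S := S) (b := b) hp (monotone_indicator_of_isUpperSet (R := R) hU)
    (fun _ => Set.indicator_nonneg (fun _ _ => zero_le_one) _) hX hW hind hS
  rwa [expect_indicator_mul_indicator, expect_indicator_mul_indicator,
    ← prob_eq_expect_indicator] at h

/-- The fibre covariance with `{a₁ ↔ a₃}` is `P(Xᶜ)·I(C'(a₃))`. -/
lemma fib_cov_eq (𝓔 : Set (Set V)) (σ₁ : {e // e ∈ awayEdges ends a₁} → Bool) {a₃ : V}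
    (h3 : a₃ ≠ a₁) :
    prob (fun i : {e // e ∉ awayEdges ends a₁} => p i)
          (fibU ends a₁ 𝓔 ∩ fib ends a₁ (connEvent ends a₁ a₃) σ₁) -
        prob (fun i : {e // e ∉ awayEdges ends a₁} => p i) (fibU ends a₁ 𝓔) *
          prob (fun i : {e // e ∉ awayEdges ends a₁} => p i) (fib ends a₁ (connEvent ends a₁ a₃) σ₁) =
      prob (fun i : {e // e ∉ awayEdges ends a₁} => p i) (fib ends a₁ (connEvent ends a₁ a₃) σ₁)ᶜ *
        Iprop ends a₁ p 𝓔 (cluster ends (baseConfig ends a₁ σ₁) a₃) := by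
  set p₂ : {e // e ∉ awayEdges ends a₁} → R := fun i => p i
  set X := fib ends a₁ (connEvent ends a₁ a₃) σ₁
  have h1 := prob_inter_add_prob_inter_compl p₂ (fibU ends a₁ 𝓔) X
  have h2 := prob_compl p₂ X
  have h3' := prob_fibU_inter_compl ends a₁ p 𝓔 σ₁ h3
  unfold Iprop
  change prob p₂ (fibU ends a₁ 𝓔 ∩ Xᶜ) = _ * prob p₂ Xᶜ at h3'
  rw [h2] at h3' ⊢
  linear_combination h1 - h3'

end Main



section FibreStep

variable (p : E → R)

/-- The per-fibre constant `m(σ₁)`: `1` if `a₃ ↔ o` in `G − a₁`, else `P(a₁ hits C'(o))`. -/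
noncomputable def mConst (σ₁ : {e // e ∈ awayEdges ends a₁} → Bool) (a₃ o : V) : R :=
  if Conn ends (baseConfig ends a₁ σ₁) a₃ o then 1
  else prob (fun i : {e // e ∉ awayEdges ends a₁} => p i) (fib ends a₁ (connEvent ends a₁ o) σ₁)

/-- **The fibre step**: `Φ(σ₁) ≥ (S·m(σ₁) − b)·Cov(U, X)`. -/
lemma fibre_step (hp : IsProbVec p) {𝓔 : Set (Set V)} (h𝓔 : IsUpperSet 𝓔)
    (σ₁ : {e // e ∈ awayEdges ends a₁} → Bool) {a₃ o : V} (h3 : a₃ ≠ a₁) (ho : o ≠ a₁)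
    {S b : R} (hS : 0 ≤ S) :
    let p₂ : {e // e ∉ awayEdges ends a₁} → R := fun i => p i
    let Uf := fibU ends a₁ 𝓔
    let X := fib ends a₁ (connEvent ends a₁ a₃) σ₁
    let W := fib ends a₁ (connEvent ends a₁ o) σ₁
    (S * mConst ends a₁ p σ₁ a₃ o - b) * (prob p₂ (Uf ∩ X) - prob p₂ Uf * prob p₂ X) ≤
      S * (prob p₂ (Uf ∩ (X ∩ W)) - prob p₂ Uf * prob p₂ (X ∩ W)) -
        b * (prob p₂ (Uf ∩ X) - prob p₂ Uf * prob p₂ X) := by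
  intro p₂ Uf X W
  by_cases hγ : Conn ends (baseConfig ends a₁ σ₁) a₃ o
  · have hXW : X = W := fib_conn_eq_of_conn ends a₁ σ₁ hγ
    have hm : mConst ends a₁ p σ₁ a₃ o = 1 := by simp [mConst, hγ]
    rw [hm, ← hXW, Set.inter_self]
    exact le_of_eq (by ring)
  · have hm : mConst ends a₁ p σ₁ a₃ o = prob p₂ W := by simp [mConst, hγ, p₂, W]
    rw [hm]
    refine cube_step_prob ends a₁ (isProbVec_restrict ends a₁ hp) (isUpperSet_fibU ends a₁ h𝓔)
      (isUpperSet_fib ends a₁ (isUpperSet_connEvent ends a₁ a₃) σ₁)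
      (isUpperSet_fib ends a₁ (isUpperSet_connEvent ends a₁ o) σ₁) ?_ hS
    exact prob_inter_eq_mul_of_dependsOn p₂ (disjoint_into ends a₁ σ₁ h3 hγ)
      (dependsOn_fib_conn ends a₁ σ₁ h3) (dependsOn_fib_conn ends a₁ σ₁ ho)

end FibreStep

end ZCDirect

end Summit.Ventures.PercRepro2
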